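import Summits.HodgeConjecture.HodgeCM.Model.Binders.IchinoExplicitDefLine_1

/-! PORT of `HodgeCM/Model/Binders/IchinoExplicitDefLine.lean` (HodgeCMPerL run 82) — part 2: continuation of `Summits.HodgeConjecture.HodgeCM.Model.Binders.IchinoExplicitDefLine_1` (split at a top-level declaration boundary by port_pkg.py; scope re-opened below; declarations unchanged). -/

-- port_pkg: scope re-opened for this part (file-level context, then the namespace/section stack open at the cut)
set_option autoImplicit false
noncomputable section
namespace HodgeCM
namespace Model
namespace Binders
namespace IchinoExplicitDefLine
open MvPolynomial Finsupp
open HodgeCM.PerL34.Fock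
open HodgeCM.Literature.Ichino2022 HodgeCM.Literature.Ichino2022.FockHarmonics
  HodgeCM.Literature.Ichino2022.HarmonicParam
section Dictionary
/-- **Ichino's Lemma 7.10 HOLDS in the explicit positive-line model `ℂ[z₁,z₂,z₃]` of `(U(1), U(3))`**
(`(p,q;r,s) = (1,0;3,0)`), for every choice of the exponents `(m₀, n₀)` carried by `S`. -/
theorem lemma_7_10_explicitPosLine (S : SplittingDatum) (hp : S.p = 1) (hq : S.q = 0) (hr : S.r = 3)
    (hs : S.s = 0) : (explicitPosLine S hr).Lemma_7_10 := by
  intro μ μ'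
  show (∃ (f : DefModel) (k t₀ t₁ t₂ : ℤ), IsHWPos f k t₀ t₁ t₂ ∧ _) ↔ _
  constructor
  · rintro ⟨f, k, t₀, t₁, t₂, hf, hμ, h0, h1, h2⟩
    obtain ⟨a, c, -, -, rfl, rfl, rfl, rfl⟩ := (isHWPos_iff f k t₀ t₁ t₂).mp hf
    by_cases ha : a = 0
    · subst ha
      refine ⟨defParam S 0 0 (by omega) (by omega) (by omega) (by omega) (by omega) Fin.elim0 Fin.elim0
        (fun i => i.elim0) (fun j => j.elim0), ?_, ?_⟩
      · ext i
        · rw [hμ i, mu_fst_apply, pad_mid _ _ _ _ (by show 0 ≤ i.val; omega) (by show i.val < S.p - 0; omega)]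
          push_cast; ring
        · exact (Fin.cast hq i).elim0
      · ext i
        · rw [mu'_fst_apply, pad_mid _ _ _ _ (by show 0 ≤ i.val; omega) (by show i.val < S.r - 0; omega)]
          rcases fin_r_cases hr i with rfl | rfl | rfl
          · rw [h0]; push_cast; ring
          · rw [h1]; push_cast; ring
          · rw [h2]; push_cast; ring
        · exact (Fin.cast hs i).elim0
    · have ha1 : 0 < (a : ℤ) := by omega
      refine ⟨defParam S 1 0 (by omega) (by omega) (by omega) (by omega) (by omega) (fun _ => a) Fin.elim0
        (fun _ => ha1) (fun j => j.elim0), ?_, ?_⟩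
      · ext i
        · rw [hμ i, mu_fst_apply, pad_head _ _ _ _ (by show i.val < 1; omega)]
          simp only [defParam]
        · exact (Fin.cast hq i).elim0
      · ext i
        · rw [mu'_fst_apply]
          rcases fin_r_cases hr i with rfl | rfl | rfl
          · rw [h0, pad_head _ _ _ _ (by show 0 < 1; omega)]
            simp only [defParam]
          · rw [h1, pad_mid _ _ _ _ (by show 1 ≤ 1; omega) (by show 1 < S.r - 0; omega)]
            push_cast; ring
          · rw [h2, pad_mid _ _ _ _ (by show 1 ≤ 2; omega) (by show 2 < S.r - 0; omega)]
            push_cast; ring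
        · exact (Fin.cast hs i).elim0
  · rintro ⟨P, hμ, hμ'⟩
    have hPq : P.qp + P.qm ≤ S.q := P.hq
    have hPs : P.pm + P.qp ≤ S.s := P.hs
    have hPp : P.pp + P.pm ≤ S.p := P.hp
    have hqm : P.qm = 0 := by omega
    have hqp : P.qp = 0 := by omega
    have hpm : P.pm = 0 := by omega
    rcases Nat.lt_or_ge 0 P.pp with hpp | hpp
    · -- `p⁺ = 1`: `z₁^{a₁}`
      have ha := P.a_pos ⟨0, hpp⟩
      have hcast : (((P.a ⟨0, hpp⟩).toNat : ℤ) : ℚ) = (P.a ⟨0, hpp⟩ : ℚ) := by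
        exact_mod_cast Int.toNat_of_nonneg ha.le
      refine ⟨_, _, _, _, _, (isHWPos_iff _ _ _ _ _).mpr
        ⟨(P.a ⟨0, hpp⟩).toNat, 1, one_ne_zero, rfl, rfl, rfl, rfl, rfl⟩, ?_, ?_, ?_, ?_⟩
      · intro i
        rw [hμ, mu_fst_apply, pad_head _ _ _ _ (by omega)]
        have : P.a ⟨i.val, by omega⟩ = P.a ⟨0, hpp⟩ := by congr 1; exact Fin.ext (by have := i.isLt; omega)
        rw [this, hcast]
      · rw [hμ', mu'_fst_apply, pad_head _ _ _ _ (by simp; omega), hcast]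
      · rw [hμ', mu'_fst_apply, pad_mid _ _ _ _ (by simp; omega) (by simp; omega)]
        push_cast; ring
      · rw [hμ', mu'_fst_apply, pad_mid _ _ _ _ (by simp; omega) (by simp; omega)]
        push_cast; ring
    · -- the vacuum
      have hpp0 : P.pp = 0 := by omega
      refine ⟨_, _, _, _, _, (isHWPos_iff _ _ _ _ _).mpr ⟨0, 1, one_ne_zero, rfl, rfl, rfl, rfl, rfl⟩,
        ?_, ?_, ?_, ?_⟩
      · intro i
        rw [hμ, mu_fst_apply, pad_mid _ _ _ _ (by omega) (by have := i.isLt; omega)]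
        push_cast; ring
      · rw [hμ', mu'_fst_apply, pad_mid _ _ _ _ (by simp; omega) (by simp; omega)]
        push_cast; ring
      · rw [hμ', mu'_fst_apply, pad_mid _ _ _ _ (by simp; omega) (by simp; omega)]
        push_cast; ring
      · rw [hμ', mu'_fst_apply, pad_mid _ _ _ _ (by simp; omega) (by simp; omega)]
        push_cast; ring

/-- **Ichino's Lemma 7.10 HOLDS in the explicit negative-line (conjugate) model of `(U(1), U(3))`**
(`(p,q;r,s) = (0,1;3,0)`). -/
theorem lemma_7_10_explicitNegLine (S : SplittingDatum) (hp : S.p = 0) (hq : S.q = 1) (hr : S.r = 3)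
    (hs : S.s = 0) : (explicitNegLine S hr).Lemma_7_10 := by
  intro μ μ'
  show (∃ (f : DefModel) (k t₀ t₁ t₂ : ℤ), IsHWNeg f k t₀ t₁ t₂ ∧ _) ↔ _
  constructor
  · rintro ⟨f, k, t₀, t₁, t₂, hf, hμ, h0, h1, h2⟩
    obtain ⟨d, c, -, -, rfl, rfl, rfl, rfl⟩ := (isHWNeg_iff f k t₀ t₁ t₂).mp hf
    by_cases hd : d = 0
    · subst hd
      refine ⟨defParam S 0 0 (by omega) (by omega) (by omega) (by omega) (by omega) Fin.elim0 Fin.elim0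
        (fun i => i.elim0) (fun j => j.elim0), ?_, ?_⟩
      · ext i
        · exact (Fin.cast hp i).elim0
        · rw [hμ i, mu_snd_apply, pad_mid _ _ _ _ (by show 0 ≤ i.val; omega) (by show i.val < S.q - 0; omega)]
          push_cast; ring
      · ext i
        · rw [mu'_fst_apply, pad_mid _ _ _ _ (by show 0 ≤ i.val; omega) (by show i.val < S.r - 0; omega)]
          rcases fin_r_cases hr i with rfl | rfl | rfl
          · rw [h0]; push_cast; ring
          · rw [h1]; push_cast; ring
          · rw [h2]; push_cast; ring
        · exact (Fin.cast hs i).elim0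
    · have hd1 : (-(d : ℤ)) < 0 := by omega
      refine ⟨defParam S 0 1 (by omega) (by omega) (by omega) (by omega) (by omega) Fin.elim0
        (fun _ => -(d : ℤ)) (fun i => i.elim0) (fun _ => hd1), ?_, ?_⟩
      · ext i
        · exact (Fin.cast hp i).elim0
        · rw [hμ i, mu_snd_apply, pad_tail _ _ _ _ (by show 0 ≤ i.val; omega) (by show S.q - 1 ≤ i.val; omega)]
          simp only [defParam]
      · ext i
        · rw [mu'_fst_apply]
          rcases fin_r_cases hr i with rfl | rfl | rfl
          · rw [h0, pad_mid _ _ _ _ (by show 0 ≤ 0; omega) (by show 0 < S.r - 1; omega)]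
            push_cast; ring
          · rw [h1, pad_mid _ _ _ _ (by show 0 ≤ 1; omega) (by show 1 < S.r - 1; omega)]
            push_cast; ring
          · rw [h2, pad_tail _ _ _ _ (by show 0 ≤ 2; omega) (by show S.r - 1 ≤ 2; omega)]
            simp only [defParam]
        · exact (Fin.cast hs i).elim0
  · rintro ⟨P, hμ, hμ'⟩
    have hPq : P.qp + P.qm ≤ S.q := P.hq
    have hPs : P.pm + P.qp ≤ S.s := P.hs
    have hPp : P.pp + P.pm ≤ S.p := P.hp
    have hPr : P.pp + P.qm ≤ S.r := P.hr
    have hpp : P.pp = 0 := by omega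
    have hpm : P.pm = 0 := by omega
    have hqp : P.qp = 0 := by omega
    rcases Nat.lt_or_ge 0 P.qm with hqm | hqm
    · -- `q⁻ = 1`: `z₃^{−d₁}`
      have hd := P.d_neg ⟨0, hqm⟩
      have hcast : (((-(P.d ⟨0, hqm⟩)).toNat : ℕ) : ℚ) = -((P.d ⟨0, hqm⟩ : ℤ) : ℚ) := by
        exact_mod_cast Int.toNat_of_nonneg (by omega : (0:ℤ) ≤ -(P.d ⟨0, hqm⟩))
      refine ⟨_, _, _, _, _, (isHWNeg_iff _ _ _ _ _).mpr
        ⟨(-(P.d ⟨0, hqm⟩)).toNat, 1, one_ne_zero, rfl, rfl, rfl, rfl, rfl⟩, ?_, ?_, ?_, ?_⟩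
      · intro j
        rw [hμ, mu_snd_apply, pad_tail _ _ _ _ (by omega) (by have := j.isLt; omega)]
        have : P.d ⟨j.val - (S.q - P.qm), by have := j.isLt; omega⟩ = P.d ⟨0, hqm⟩ := by
          congr 1; exact Fin.ext (by have := j.isLt; simp; omega)
        rw [this]; push_cast; rw [hcast]; ring
      · rw [hμ', mu'_fst_apply, pad_mid _ _ _ _ (by omega) (by simp; omega)]
        push_cast; ring
      · rw [hμ', mu'_fst_apply, pad_mid _ _ _ _ (by omega) (by simp; omega)]
        push_cast; ring
      · rw [hμ', mu'_fst_apply, pad_tail _ _ _ _ (by omega) (by simp; omega)]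
        have : P.d ⟨2 - (S.r - P.qm), by omega⟩ = P.d ⟨0, hqm⟩ := by
          congr 1; exact Fin.ext (by simp; omega)
        rw [this]; push_cast; rw [hcast]; ring
    · -- the vacuum
      have hqm0 : P.qm = 0 := by omega
      refine ⟨_, _, _, _, _, (isHWNeg_iff _ _ _ _ _).mpr ⟨0, 1, one_ne_zero, rfl, rfl, rfl, rfl, rfl⟩,
        ?_, ?_, ?_, ?_⟩
      · intro j
        rw [hμ, mu_snd_apply, pad_mid _ _ _ _ (by omega) (by have := j.isLt; omega)]
        push_cast; ring
      · rw [hμ', mu'_fst_apply, pad_mid _ _ _ _ (by omega) (by simp; omega)]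
        push_cast; ring
      · rw [hμ', mu'_fst_apply, pad_mid _ _ _ _ (by omega) (by simp; omega)]
        push_cast; ring
      · rw [hμ', mu'_fst_apply, pad_mid _ _ _ _ (by omega) (by simp; omega)]
        push_cast; ring

end Dictionary

end IchinoExplicitDefLine
end Binders
end Model
end HodgeCM

-- port_pkg: scope closed for this part
end
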